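/-
Copyright: lit-balaban Phase-2 proof seat p29 (gen 29).  Statement-level skeleton of a published paper; no proof claims beyond what the
kernel checks below.
-/
import Literature.MathematicalPhysics.QuantumFieldTheory.BalabanImbrieJaffe1984to88.BIJ88Close231RegularTorusCwt
import Literature.MathematicalPhysics.QuantumFieldTheory.BalabanImbrieJaffe1984to88.BIJ88LocDeriv230SmallFieldTorus

/-!
# `BalabanImbrieJaffe1984to88.BIJ88LocHolder231RegularTorus` — T. Bałaban, J. Imbrie, A. Jaffe, *Effective action and cluster properties of
the abelian Higgs model*, Commun. Math. Phys. **114** (1988) 257–315 [BalabanImbrieJaffe1988], Sect. 2 p. 263 [PDF 7], the sentence after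
(2.33): *"Bounds analogous to (2.30), (2.31) hold for covariant derivatives and Hölder derivatives of G_{k,loc}(u) of order less than two"* —
**THE HÖLDER MEMBER OF ORDER `θ ≤ 1` OF (2.31) WITH `Ω = T_η` AT A (2.23)-REGULAR NON-FLAT BACKGROUND `u = e^{ieεA}`, FOR THE PRINTED
LOCALIZATION DATA WITH BIG-BLOCK CUBES** (r18 gen 24's `BIJ88Close231RegularTorusCwt`: the big-block hulls `cubeFamB` of gen 26's torus cubes,
the weights `λ_α` of (2.27), p13's cut-off `ζ″` of (2.29)): the gauge-covariant Hölder quotient `(L^k/|x₁ − x₂|_T)^θ·|u(Γ_{x₁x₂})ψ(x₂) − ψ(x₁)|`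
of the DIFFERENCE `ψ = G_{k,loc}(u)f − G_k(T_η,u)f`, the parallel transport `u(Γ)` taken along a bond chain `Γ` AT THE NON-FLAT FIELD, obeys
r18's (2.31)-type derivative bracket times `(L^kε)²·e^{−(δ₀/2)D/L^k}‖f‖_∞` for every pair of points deep inside the reference box `Ω₀` joined by
an admissible contour, every `0 ≤ θ ≤ 1` — the companion at regular `u` of gen 29's flat `BIJ88LocHolder231FlatTorus.holder231_flat_cwt`.

statement-level skeleton of published theorems with citation tags; proofs where landed; nothing here is a claim about the Yang–Mills mass gap

PDF held: `paper:balaban1988-cmp114-bij-abelian-higgs-effective-action` (journal page = PDF page + 256); p. 263 [PDF 7] re-read this session on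
the page render `run/shared/lean/pub/lit-balaban/lit-balaban-p31/renders/original-p007-x2.png`; [6] = [Balaban1983RegularityDecay] p. 573
(*"Γ_{x,x′} a shortest contour connecting these points"*, the transport `U(A(Γ_{x,x′}))` of (1.9)) re-read from the text layer of
`paper:balaban1983-cmp89-regularity-decay`.

CITATION HEADER (lean-in-tree rule).  Part of the lit-balaban TYPED SKELETON (HOME `run/shared/lean/pub/lit-balaban/`), PHASE-2 proof seat
p29 gen 29 (unit `lit-balaban-p29-g29`; TAKING line HOME/STATUS.md 2026-08-23T02:3xZ — the row owner r18 gen 24's hand-over of 02:26Z *"On the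
Hölder θ ≤ 1 member of (2.31) at regular u: yours, please (your `holder231_flat_cwt` telescoping is the pattern …)"*; free-target protocol
G.5-34(d)).  Rows **C2.Eq2.31** / **C2.Claim@263** (owner r18; the abstract hence-step is p08's `BIJ88HolderDecay230`, unchanged; the value and
covariant-derivative members of (2.31) at the regular background are r18's `opClose231_regular_torus_cwt` / `deriv231_regular_torus_cwt`, whose
inputs are r01's (2.23)-regular providers of [7] (1.10)/(1.11)–(1.12)).  Kind: theorems only (no definition, no `Prop`-valued fact; r18's / gen
26–29's / T4's declarations used BY NAME).

THE PRINTED TEXT (verbatim, p. 263).  *"|(G_{k,loc}(u)f − G_k(Ω,u)f)(x)| ≦ e^{−cr(e_k)}e^{−c dist(suppt f,x)}‖f‖_∞, (2.31) for dist(x,Ω^c) ≧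
O(r(e_k)). [Each G_k(□_α,u) is close to G_k(Ω,u) for the relevant x₁, x₂, therefore the convex combination and G_{k,loc} are close also.] … for
(2.31) we assume smoothness throughout the subset Ω ⊂ T_η … Bounds analogous to (2.30), (2.31) hold for covariant derivatives and Hölder
derivatives of G_{k,loc}(u) of order less than two."*

THE MECHANISM (ours, declared — gen 29's small-field telescoping with r18's regular-background (2.31) members as the inputs).  NEAR PAIRS
(`|x₁ − x₂|_T ≤ L^k`): along a bond chain `Γ = (x₁ = s_0, …, s_n = x₂)` the transported difference telescopes bond by bond AT THE NON-FLAT `u`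
(gen 29's `BIJ88LocDeriv230SmallFieldTorus.norm_transport_sub_le_sum_covD`: `‖u(Γ)ψ(s_n) − ψ(s_0)‖ ≤ ε·Σ_m‖(D_uψ)(c_m)‖`, `|u| = 1`), each bond
costing `ε` times r18's covariant-derivative analogue of (2.31) (`deriv231_regular_torus_cwt`; `D_uψ = D_u(G_{k,loc}f) − D_u(G_k(T_η)f)` by
additivity) at the support distance `≥ D − |x₁ − x₂|_T ≥ D − L^k` seen from the contour; the weight `(L^k/T)^θ ≤ L^k/T` (`θ ≤ 1`) against the
`≤ (d+1)T` steps leaves `(d+1)·L^kε`.  FAR PAIRS (`|x₁ − x₂|_T > L^k`): weight `≤ 1`, two value members (`opClose231_regular_torus_cwt`),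
`|u(Γ)| = 1`.  Both inputs decay at the SAME explicit rate `δ₀ = 1/(8L^s)`, so the bracket of the radii is r18's §6 bracket verbatim (the value
member's `e^{−2δ₀R/L^k}`, `e^{−(δ₀/2)R₁/L^k}` are dominated by `e^{−δ₀(2R−1)/L^k}`, `e^{−(δ₀/2)(R₁−1)/L^k}`).  ADMISSIBLE CONTOURS (all sites in `Ω₀`
at chart depth `≥ R₀ + R`, within `|x₁ − x₂|_T` of `x₁`, `≤ (d+1)|x₁ − x₂|_T` steps) exist between deep points at torus distance `≤ R₀ + R`:
gen 29's chart staircase `exists_admissible_contour` (§3).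

WHAT IS PROVED (theorems only; 0 `sorry`; standard axioms).
* §1 (private) `rpow_le_self_of_one_le`, `covD_sub`.
* §2 **`holder231_regular_torus_cwt`** — `∃ s₀ ∀ s ≥ s₀ ∃ c₀ e₁ > 0` (from `(d, L, a, e, c, β, s)` only) such that on every torus of the series
  (`P.d = d+1`, `P.L = L ≥ 2`), at every level `1 ≤ k ≤ K` with `k + s ≤ m + K`, `3L^kL^s ≤ |T^{(0)}|`, for every `A` (2.23)-regular on `T^{(0)}`
  (`0 < e_k ≤ e₁`), `u = e^{ieεA}` (`expGauge P e A`), every reference no-wrap box `Ω₀ = c·L^k + Π_i[0, L^kM₀_i)` shorter than the torus with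
  torus gap `≥ R`, grid spacing `s_g ≥ 1`, half-width `W ≥ 2s_g/3 + R₀/2 + R`, radii `R > rowMargin + 1`, `0 ≤ R₁ < R₀`, every `0 ≤ θ ≤ 1`,
  every admissible bond chain `Γ` from `x₁` to `x₂`, every `f` with `‖f‖_∞ ≤ F` supported at sup-torus distance `≥ D ≥ 0` from both points:
  `(L^k/|x₁ − x₂|_T)^θ·‖u(Γ)ψ(x₂) − ψ(x₁)‖ ≤
   (L^kε)²·c₀·[m(1 + L^k((R₀−R₁)⁻¹ + s_g⁻¹))e^{−δ₀(2R−1)/L^k} + (1 + L^k(R₀−R₁)⁻¹)e^{−(δ₀/2)(R₁−1)/L^k}]·e^{−(δ₀/2)D/L^k}·F`, `δ₀ = 1/(8L^s)`,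
  `m = (⌊(L^k − 1 + R₀)/s_g⌋ + 3)^{d+1}` — at the printed radii (`R, R₁ ~ r(e_k)L^k ≫ rowMargin`; `s_g, R₀ − R₁ ≫ L^k`) the bracket is print's
  `e^{−cr(e_k)}`.
* §3 **`exists_contour_holder231_regular_torus_cwt`** — [6]'s shortest-contour ∃-form: for `x₁, x₂ ∈ Ω₀` at chart depth `≥ R₀ + R` with
  `|x₁ − x₂|_T ≤ R₀ + R` there is a bond chain of `≤ (d+1)|x₁ − x₂|_T` steps along which §2's bound holds for every `θ`, `f`.
HONEST SCOPE / DIVERGENCE.  (i) `u` is EXACTLY `e^{ieεA}` with `A` (2.23)-regular ON THE WHOLE TORUS and `Ω = T_η` (r18's HONEST SCOPE (ii)–(iii)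
inherited: no change of gauge, no `Ω = Ω₀` comparison; bondwise/plaquette-small `u` beyond regular `A` is not here).  (ii) ORDER `θ ≤ 1` ONLY
(quotients of the VALUES of `ψ`); the order `1 + θ` member needs [6] (1.9)+(1.12) for the hulls at regular `u` with the transport (r01's
`BIJ85NeumannPropagatorRegularHolder`, in review) threaded through p31's `_gen` chain — not here.  (iii) THE CUBES ARE r18's BIG-BLOCK HULLS
`cubeFamB` (r18's divergence (iv)), the `G_{k,loc}(u)` is the (2.28) object of THAT family.  (iv) The transport is T4's ordered holonomy `chainHol`
of an arbitrary admissible chain (print: a shortest contour; every admissible chain gives the same bound); far pairs need no admissibility but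
the statement keeps one shape.  (v) Constants: `s₀, c₀, e₁` existential (r18's/r01's thresholds; `c₀ = max((d+1)e^{δ₀/2}c₁, 2c₂)`), `δ₀`
explicit; no non-vacuity instance (r18's (v): the thresholds are not computable from the tree's statements).  (vi) `set_option maxHeartbeats
400000` on §2 (elaboration budget only).  Imports: r18 `BIJ88Close231RegularTorusCwt` (v1.1, → r01 `BIJ85NeumannPropagatorRegularClose`/`…Deriv`,
p31, gen 26/27), gen 29 `BIJ88LocDeriv230SmallFieldTorus` (→ T4 `T4TreeGaugeTransform`, p34).  Literature + Mathlib only.  Unit `lit-balaban-p29`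
(literature-prover-lit-balaban-p29-g29-0), 2026-08-23.  NOT summit progress.
-/

open scoped BigOperators Matrix ComplexConjugate
open Finset Matrix

namespace Literature.MathematicalPhysics.QuantumFieldTheory.BalabanImbrieJaffe1984to88.BIJ88LocHolder231RegularTorus

open Literature.MathematicalPhysics.QuantumFieldTheory.Balaban1983to89
open BIJ88Sect3Statements (U1 toC cfg covD norm_toC)
open BIJ85BlockAveragesTorus BIJ85BlockAveragesTorusK
open BIJ88NeumannPropagator227Torus (gBox)
open BIJ88DeltaLoc234Torus (gLocT)
open BIJ88NeumannPropagatorFlatDecayCube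
open BIJ88Cutoffs21 (cutoff)
open BIJ88LocWeights227Torus
open BIJ85CovariantHiggsDictionary (expGauge)
open BIJ88Close231RegularTorusCwt (cubeFamB rowMargin deriv231_regular_torus_cwt opClose231_regular_torus_cwt)
open BIJ88LocDeriv230SmallFieldTorus (norm_transport_sub_le_sum_covD exists_admissible_contour)
open T4TreeGaugeFixing (Joins)
open T4TreeGaugeTransform (chainHol)

noncomputable section

variable {d : ℕ} {P : Params}

/-! ## §1 Kernel lemmas -/

/-- kernel: for `1 ≤ t` and `θ ≤ 1`, `t^θ ≤ t`. [folklore] -/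
private theorem rpow_le_self_of_one_le {t θ : ℝ} (ht : 1 ≤ t) (hθ : θ ≤ 1) : t ^ θ ≤ t := by
  have h := Real.rpow_le_rpow_of_exponent_le ht hθ
  rwa [Real.rpow_one] at h

/-- kernel: the covariant derivative is additive in the function: `D_u(φ − ψ) = D_uφ − D_uψ`. [cite: BalabanImbrieJaffe1988, (3.3) p.265] -/
private theorem covD_sub {j : ℕ} (c' : ℝ) (u : PBond P j → ℂ) (φ ψ : Balaban1983to89.Site P j → ℂ) (b : PBond P j) :
    covD c' u (φ - ψ) b = covD c' u φ b - covD c' u ψ b := by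
  simp only [covD, Pi.sub_apply]; ring

/-! ## §2 The Hölder member of order `θ ≤ 1` of (2.31), `Ω = T_η`, at a (2.23)-regular background, along admissible contours -/

section Holder

set_option maxHeartbeats 400000 in
/-- **THE HÖLDER MEMBER OF ORDER `θ ≤ 1` OF (2.31) WITH `Ω = T_η` AT A (2.23)-REGULAR NON-FLAT BACKGROUND `u = e^{ieεA}`, FOR THE PRINTED
LOCALIZATION DATA WITH BIG-BLOCK CUBES, ALONG EVERY ADMISSIBLE CONTOUR** (p. 263: *"|(G_{k,loc}(u)f − G_k(Ω,u)f)(x)| ≦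
e^{−cr(e_k)}e^{−c dist(suppt f,x)}‖f‖_∞ (2.31) … Bounds analogous to (2.30), (2.31) hold for covariant derivatives and Hölder derivatives of
G_{k,loc}(u) of order less than two"*; [6] p. 573 (1.9): the transport `U(A(Γ_{x,x′}))` along *"a shortest contour connecting these points"*).
`∃ s₀ ∀ s ≥ s₀ ∃ c₀ e₁ > 0` (from `(d, L, a, e, c, β, s)` only) such that on every torus of the series (`P.d = d+1`, `P.L = L ≥ 2`), at every
level `1 ≤ k ≤ K` with `k + s ≤ m + K`, `3L^kL^s ≤ |T^{(0)}|`, for every `A` (2.23)-regular on `T^{(0)}` (`0 < e_k ≤ e₁`), every reference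
no-wrap box `Ω₀ = c·L^k + Π_i[0, L^kM₀_i)` shorter than the torus with torus gap `≥ R`, grid spacing `s_g ≥ 1`, half-width
`W ≥ 2s_g/3 + R₀/2 + R`, radii `R > rowMargin + 1`, `0 ≤ R₁ < R₀`, EVERY exponent `0 ≤ θ ≤ 1`, every pair `x₁, x₂` joined by a bond chain
`Γ = (x₁ = s_0, …, s_n = x₂)` of `n ≤ (d+1)|x₁ − x₂|_T` steps all of whose sites lie in `Ω₀` at chart depth `≥ R₀ + R` and within sup-torus
distance `|x₁ − x₂|_T` of `x₁` (§3: the chart staircase is such a contour for near deep pairs), and every `f` with `‖f‖_∞ ≤ F` supported at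
sup-torus distance `≥ D ≥ 0` from `x₁` and from `x₂`: with `ψ = G_{k,loc}(u)f − G_k(T_η,u)f`,
`(L^k/|x₁ − x₂|_T)^θ·‖u(Γ)ψ(x₂) − ψ(x₁)‖ ≤
 (L^kε)²·c₀·[m(1 + L^k((R₀−R₁)⁻¹ + s_g⁻¹))e^{−δ₀(2R−1)/L^k} + (1 + L^k(R₀−R₁)⁻¹)e^{−(δ₀/2)(R₁−1)/L^k}]·e^{−(δ₀/2)D/L^k}·F`, `δ₀ = 1/(8L^s)`,
`m = (⌊(L^k−1+R₀)/s_g⌋+3)^{d+1}`, `u(Γ) = Π_m u(c_m)^{±1}` (T4's `chainHol`) — NEAR PAIRS (`|x₁ − x₂|_T ≤ L^k`): r18's covariant-derivative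
analogue of (2.31) (`deriv231_regular_torus_cwt`, for `D_uψ` by additivity) telescoped bond by bond along `Γ` at the non-flat `u`
(p29's `norm_transport_sub_le_sum_covD`), `(L^k/T)^θ·(d+1)T·ε ≤ (d+1)L^kε`, support distance `≥ D − L^k` from the contour; FAR PAIRS: two value
members (`opClose231_regular_torus_cwt`), `|u(Γ)| = 1`; both inputs at the same rate `δ₀ = 1/(8L^s)`, so the bracket is r18's.
[cite: BalabanImbrieJaffe1988, (2.31) p.263] -/
theorem holder231_regular_torus_cwt (d L : ℕ) (hL : 2 ≤ L) {a : ℝ} (ha : 0 < a) (e creg β : ℝ) (hcreg : 0 ≤ creg) (hβ : 0 < β) :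
    ∃ s₀ : ℕ, ∀ s : ℕ, s₀ ≤ s → ∃ c₀ e₁ : ℝ, 0 < c₀ ∧ 0 < e₁ ∧
      ∀ (P : Params) (hPd : P.d = d + 1), P.L = L → ∀ (k : ℕ), 1 ≤ k → k ≤ P.K → k + s ≤ P.m + P.K →
      3 * (L ^ k * L ^ s) ≤ P.sitesPerDir 0 →
      ∀ (A : PBond P 0 → ℝ) (ec : ℝ), 0 < ec → ec ≤ e₁ →
      (∀ (z : Balaban1983to89.Site P 0) (μ ν : Fin P.d),
          P.spacing k * |e| / ec * |A ⟨z.shift μ, ν⟩ - A ⟨z, ν⟩| ≤ creg * ec ^ (β - 1) / (L : ℝ) ^ k) →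
      ∀ (c M0 : Fin (d + 1) → ℕ), (∀ i, c i * P.L ^ k + P.L ^ k * M0 i ≤ P.sitesPerDir 0) → (∀ i, P.L ^ k * M0 i < P.sitesPerDir 0) →
      ∀ (sg W : ℕ), 1 ≤ sg → ∀ (R R₀ R₁ : ℝ), ((rowMargin L (d + 1) k s : ℕ) : ℝ) + 1 < R → 0 ≤ R₁ → R₁ < R₀ →
        2 * (sg : ℝ) / 3 + R₀ / 2 + R ≤ W → (∀ i, ((P.L ^ k * M0 i : ℕ) : ℝ) + R ≤ P.sitesPerDir 0) →
      ∀ (θ : ℝ), 0 ≤ θ → θ ≤ 1 →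
      ∀ (x₁ x₂ : Balaban1983to89.Site P 0) (n : ℕ) (sq : ℕ → Balaban1983to89.Site P 0) (cb : ℕ → PBond P 0),
        sq 0 = x₁ → sq n = x₂ → (∀ m < n, Joins (cb m) (sq m) (sq (m + 1))) →
        (n : ℝ) ≤ ((d : ℝ) + 1) * B5Ineq137Torus.T P 0 x₁ x₂ →
        (∀ m ≤ n, sq m ∈ (cubeT hPd (P.L ^ k) c fun i => P.L ^ k * M0 i) ∧
          (∀ i, R₀ + R ≤ (boxCoord hPd (P.L ^ k) c (sq m) i : ℝ) ∧
            (boxCoord hPd (P.L ^ k) c (sq m) i : ℝ) + (R₀ + R) ≤ (P.L ^ k * M0 i : ℕ) - 1) ∧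
          B5Ineq137Torus.T P 0 x₁ (sq m) ≤ B5Ineq137Torus.T P 0 x₁ x₂) →
      ∀ (f : Balaban1983to89.Site P 0 → ℂ) (F D : ℝ), (∀ y, ‖f y‖ ≤ F) → 0 ≤ D →
        (∀ y, f y ≠ 0 → D ≤ B5Ineq137Torus.T P 0 x₁ y) → (∀ y, f y ≠ 0 → D ≤ B5Ineq137Torus.T P 0 x₂ y) →
        ((P.L : ℝ) ^ k / B5Ineq137Torus.T P 0 x₁ x₂) ^ θ *
          ‖toC (chainHol sq cb (expGauge P e A) n) *
              ((gLocT (B1RG242Torus.α P a k * (P.L : ℝ) ^ (k * P.d)) P.eps⁻¹ (expGauge P e A) k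
                  (cubeFamB hPd (P.L ^ k) c M0 sg W (L ^ k * L ^ s)) (lamFam hPd (P.L ^ k) c M0 sg)
                  (cutoff R₁ R₀ (B5Ineq137Torus.T P 0)) *ᵥ f) x₂ -
                (gBox (B1RG242Torus.α P a k * (P.L : ℝ) ^ (k * P.d)) P.eps⁻¹ (expGauge P e A) k univ *ᵥ f) x₂) -
            ((gLocT (B1RG242Torus.α P a k * (P.L : ℝ) ^ (k * P.d)) P.eps⁻¹ (expGauge P e A) k
                  (cubeFamB hPd (P.L ^ k) c M0 sg W (L ^ k * L ^ s)) (lamFam hPd (P.L ^ k) c M0 sg)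
                  (cutoff R₁ R₀ (B5Ineq137Torus.T P 0)) *ᵥ f) x₁ -
                (gBox (B1RG242Torus.α P a k * (P.L : ℝ) ^ (k * P.d)) P.eps⁻¹ (expGauge P e A) k univ *ᵥ f) x₁)‖ ≤
          P.spacing k ^ 2 * (c₀ * ((⌊(((P.L : ℝ) ^ k) - 1 + R₀) / sg⌋₊ + 3) ^ (d + 1) * (1 + (P.L : ℝ) ^ k * ((R₀ - R₁)⁻¹ + (sg : ℝ)⁻¹)) *
              Real.exp (-(1 / (8 * (L : ℝ) ^ s) * (((P.L : ℝ) ^ k)⁻¹ * (2 * R - 1)))) +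
            (1 + (P.L : ℝ) ^ k * (R₀ - R₁)⁻¹) * Real.exp (-(1 / (8 * (L : ℝ) ^ s) / 2 * (((P.L : ℝ) ^ k)⁻¹ * (R₁ - 1))))) *
            Real.exp (-(1 / (8 * (L : ℝ) ^ s) / 2 * (((P.L : ℝ) ^ k)⁻¹ * D))) * F) := by
  obtain ⟨s₁, H1⟩ := deriv231_regular_torus_cwt d L hL ha e creg β hcreg hβ
  obtain ⟨s₂, H2⟩ := opClose231_regular_torus_cwt d L hL ha e creg β hcreg hβ
  refine ⟨max s₁ s₂, fun s hs => ?_⟩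
  obtain ⟨c₁, e₁, hc₁, he₁, G1⟩ := H1 s ((le_max_left _ _).trans hs)
  obtain ⟨c₂, e₂, hc₂, he₂, G2⟩ := H2 s ((le_max_right _ _).trans hs)
  set δ₀ : ℝ := 1 / (8 * (L : ℝ) ^ s) with hδ₀def
  refine ⟨max (((d : ℝ) + 1) * Real.exp (δ₀ / 2) * c₁) (2 * c₂), min e₁ e₂, lt_max_of_lt_right (by positivity), lt_min he₁ he₂, ?_⟩
  intro P hPd hPL k hk1 hkK hks hsize A ec hec hece hreg c M0 hfit0 hN0 sg W hsg R R₀ R₁ hRm hR₁ hR10 hW hgap θ hθ0 hθ1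
    x₁ x₂ n sq cb hsq0 hsqn hJ hnle hchain f F D hF hD hsupp₁ hsupp₂
  have hece₁ : ec ≤ e₁ := hece.trans (min_le_left _ _)
  have hece₂ : ec ≤ e₂ := hece.trans (min_le_right _ _)
  have hRm' : ((rowMargin L (d + 1) k s : ℕ) : ℝ) < R := by linarith
  set C := max (((d : ℝ) + 1) * Real.exp (δ₀ / 2) * c₁) (2 * c₂) with hCdef
  have hC1 : ((d : ℝ) + 1) * Real.exp (δ₀ / 2) * c₁ ≤ C := le_max_left _ _
  have hC2 : 2 * c₂ ≤ C := le_max_right _ _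
  have hC0 : 0 ≤ C := le_trans (by positivity) hC2
  have hLr : (0 : ℝ) < L := by exact_mod_cast (show 0 < L by omega)
  have hδ₀0 : 0 < δ₀ := by rw [hδ₀def]; positivity
  have hLpos : (0 : ℝ) < P.L := P.cast_L_pos
  have hLk : (0 : ℝ) < (P.L : ℝ) ^ k := pow_pos hLpos _
  have hLkinv : 0 < ((P.L : ℝ) ^ k)⁻¹ := inv_pos.mpr hLk
  have hF0 : 0 ≤ F := (norm_nonneg _).trans (hF x₁)
  have hsp0 : 0 < P.spacing k := P.spacing_pos k
  have heps : 0 < P.eps := P.eps_pos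
  have hsr : (0 : ℝ) < sg := by exact_mod_cast hsg
  have hgap' : 0 < R₀ - R₁ := sub_pos.2 hR10
  have hT0 : 0 ≤ B5Ineq137Torus.T P 0 x₁ x₂ := B5Ineq137Torus.T_nonneg P 0 x₁ x₂
  -- the end points are chain sites
  obtain ⟨hx₁, hdeep₁, -⟩ := hsq0 ▸ hchain 0 (Nat.zero_le n)
  obtain ⟨hx₂, hdeep₂, -⟩ := hsqn ▸ hchain n le_rfl
  -- abbreviations
  set Aop : ℝ := B1RG242Torus.α P a k * (P.L : ℝ) ^ (k * P.d) with hAdef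
  set U : GaugeField P 0 U1 := expGauge P e A with hUdef
  set ζ := cutoff R₁ R₀ (B5Ineq137Torus.T P 0) with hζdef
  set ψL : Balaban1983to89.Site P 0 → ℂ :=
    gLocT Aop P.eps⁻¹ U k (cubeFamB hPd (P.L ^ k) c M0 sg W (L ^ k * L ^ s)) (lamFam hPd (P.L ^ k) c M0 sg) ζ *ᵥ f with hψLdef
  set ψΩ : Balaban1983to89.Site P 0 → ℂ := gBox Aop P.eps⁻¹ U k univ *ᵥ f with hψΩdef
  set ψ : Balaban1983to89.Site P 0 → ℂ := ψL - ψΩ with hψdef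
  have hψ : ∀ x, ψL x - ψΩ x = ψ x := fun x => rfl
  set T12 : ℝ := B5Ineq137Torus.T P 0 x₁ x₂ with hT12def
  set m : ℝ := ((⌊(((P.L : ℝ) ^ k) - 1 + R₀) / sg⌋₊ : ℝ) + 3) ^ (d + 1) with hmdef
  have hm0 : 0 ≤ m := by rw [hmdef]; positivity
  set br : ℝ := 1 + (P.L : ℝ) ^ k * ((R₀ - R₁)⁻¹ + (sg : ℝ)⁻¹) with hbrdef
  have hbr1 : 1 ≤ br := by rw [hbrdef]; exact le_add_of_nonneg_right (by positivity)
  have hbr0 : 0 ≤ br := zero_le_one.trans hbr1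
  set br₁ : ℝ := 1 + (P.L : ℝ) ^ k * (R₀ - R₁)⁻¹ with hbr₁def
  have hbr₁1 : 1 ≤ br₁ := by rw [hbr₁def]; exact le_add_of_nonneg_right (by positivity)
  have hbr₁0 : 0 ≤ br₁ := zero_le_one.trans hbr₁1
  set ER : ℝ := Real.exp (-(δ₀ * (((P.L : ℝ) ^ k)⁻¹ * (2 * R - 1)))) with hERdef
  set ER₁ : ℝ := Real.exp (-(δ₀ / 2 * (((P.L : ℝ) ^ k)⁻¹ * (R₁ - 1)))) with hER₁def
  set Ex : ℝ := Real.exp (-(δ₀ / 2 * (((P.L : ℝ) ^ k)⁻¹ * D))) with hEdef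
  have hER0 : 0 < ER := Real.exp_pos _
  have hER₁0 : 0 < ER₁ := Real.exp_pos _
  have hE0 : 0 < Ex := Real.exp_pos _
  set Br : ℝ := m * br * ER + br₁ * ER₁ with hBrdef
  have hBr0 : 0 ≤ Br := by positivity
  have hεD : 0 ≤ ((P.L : ℝ) ^ k)⁻¹ * D := mul_nonneg hLkinv.le hD
  -- the value member's exponentials are dominated by the derivative member's
  have hER_2 : Real.exp (-(δ₀ * (((P.L : ℝ) ^ k)⁻¹ * (2 * R)))) ≤ ER :=
    Real.exp_le_exp.2 (neg_le_neg (mul_le_mul_of_nonneg_left (mul_le_mul_of_nonneg_left (by linarith) hLkinv.le) hδ₀0.le))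
  have hER₁_2 : Real.exp (-(δ₀ / 2 * (((P.L : ℝ) ^ k)⁻¹ * R₁))) ≤ ER₁ :=
    Real.exp_le_exp.2 (neg_le_neg (mul_le_mul_of_nonneg_left (mul_le_mul_of_nonneg_left (by linarith) hLkinv.le) (by positivity)))
  -- the weight
  set w : ℝ := ((P.L : ℝ) ^ k / T12) ^ θ with hwdef
  have hw0 : 0 ≤ w := Real.rpow_nonneg (div_nonneg hLk.le hT0) θ
  show w * ‖toC (chainHol sq cb U n) * (ψL x₂ - ψΩ x₂) - (ψL x₁ - ψΩ x₁)‖ ≤ _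
  rw [hψ, hψ]
  -- the target, factorised
  have hRHS : P.spacing k ^ 2 * (C * Br * Ex * F) =
      P.spacing k ^ 2 * (C * ((⌊(((P.L : ℝ) ^ k) - 1 + R₀) / sg⌋₊ + 3) ^ (d + 1) * (1 + (P.L : ℝ) ^ k * ((R₀ - R₁)⁻¹ + (sg : ℝ)⁻¹)) *
          Real.exp (-(δ₀ * (((P.L : ℝ) ^ k)⁻¹ * (2 * R - 1)))) +
        (1 + (P.L : ℝ) ^ k * (R₀ - R₁)⁻¹) * Real.exp (-(δ₀ / 2 * (((P.L : ℝ) ^ k)⁻¹ * (R₁ - 1))))) *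
        Real.exp (-(δ₀ / 2 * (((P.L : ℝ) ^ k)⁻¹ * D))) * F) := by
    rw [hBrdef, hmdef, hbrdef, hbr₁def, hERdef, hER₁def, hEdef]
  rw [← hRHS]
  by_cases hnear : T12 ≤ (P.L : ℝ) ^ k
  · /- NEAR PAIRS: r18's derivative member telescoped along the contour at the non-flat `u` -/
    -- the shortened support distance along the contour
    set D' : ℝ := max (D - T12) 0 with hD'def
    have hD'0 : 0 ≤ D' := le_max_right _ _
    -- the per-bond bound
    set B₁ : ℝ := P.spacing k * (c₁ * (((⌊(((P.L : ℝ) ^ k) - 1 + R₀) / sg⌋₊ : ℝ) + 3) ^ (d + 1) *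
        (1 + (P.L : ℝ) ^ k * ((R₀ - R₁)⁻¹ + (sg : ℝ)⁻¹)) * Real.exp (-(1 / (8 * (L : ℝ) ^ s) * (((P.L : ℝ) ^ k)⁻¹ * (2 * R - 1)))) +
      (1 + (P.L : ℝ) ^ k * (R₀ - R₁)⁻¹) * Real.exp (-(1 / (8 * (L : ℝ) ^ s) / 2 * (((P.L : ℝ) ^ k)⁻¹ * (R₁ - 1))))) *
      Real.exp (-(1 / (8 * (L : ℝ) ^ s) / 2 * (((P.L : ℝ) ^ k)⁻¹ * D'))) * F) with hB₁def
    have hB₁0 : 0 ≤ B₁ := by rw [hB₁def]; positivity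
    have hbond : ∀ m' < n, ‖covD P.eps⁻¹ (cfg U) ψ (cb m')‖ ≤ B₁ := by
      intro m' hm'
      obtain ⟨hmem0, hdeep0, hclose0⟩ := hchain m' hm'.le
      obtain ⟨hmem1, hdeep1, hclose1⟩ := hchain (m' + 1) (Nat.succ_le_of_lt hm')
      have hb : cb m' = ⟨(cb m').src, (cb m').dir⟩ := rfl
      have htgt : (cb m').tgt = (cb m').src.shift (cb m').dir := rfl
      -- both endpoints of the bond are chain sites
      have hends : ((cb m').src ∈ (cubeT hPd (P.L ^ k) c fun i => P.L ^ k * M0 i) ∧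
          (∀ i, R₀ + R ≤ (boxCoord hPd (P.L ^ k) c (cb m').src i : ℝ) ∧
            (boxCoord hPd (P.L ^ k) c (cb m').src i : ℝ) + (R₀ + R) ≤ (P.L ^ k * M0 i : ℕ) - 1) ∧
          B5Ineq137Torus.T P 0 x₁ (cb m').src ≤ T12) ∧
          ((cb m').src.shift (cb m').dir ∈ (cubeT hPd (P.L ^ k) c fun i => P.L ^ k * M0 i) ∧
          (∀ i, R₀ + R ≤ (boxCoord hPd (P.L ^ k) c ((cb m').src.shift (cb m').dir) i : ℝ) ∧
            (boxCoord hPd (P.L ^ k) c ((cb m').src.shift (cb m').dir) i : ℝ) + (R₀ + R) ≤ (P.L ^ k * M0 i : ℕ) - 1)) := by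
        rw [← htgt]
        rcases hJ m' hm' with ⟨h1, h2⟩ | ⟨h1, h2⟩
        · rw [h1, h2]; exact ⟨⟨hmem0, hdeep0, hclose0⟩, hmem1, hdeep1⟩
        · rw [h1, h2]; exact ⟨⟨hmem1, hdeep1, hclose1⟩, hmem0, hdeep0⟩
      obtain ⟨⟨hzmem, hzdeep, hzclose⟩, hzemem, hzedeep⟩ := hends
      -- the support of `f` seen from the bond: `≥ D − T12`
      have hD'supp : ∀ y, f y ≠ 0 → D' ≤ B5Ineq137Torus.T P 0 (cb m').src y := by
        intro y hy
        refine max_le ?_ (B5Ineq137Torus.T_nonneg P 0 _ y)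
        have h1 := hsupp₁ y hy
        have h2 := B5Ineq137Torus.T_triangle P 0 x₁ (cb m').src y
        linarith
      have hder := G1 P hPd hPL k hk1 hkK hks hsize A ec hec hece₁ hreg c M0 hfit0 hN0 sg W hsg R R₀ R₁ hRm hR₁ hR10 hW hgap
        (cb m').src (cb m').dir hzmem hzdeep hzemem hzedeep f F D' hF hD'0 hD'supp
      rw [← covD_sub, ← hb] at hder
      exact hder
    -- telescoping along the contour
    have htel := norm_transport_sub_le_sum_covD U (inv_ne_zero heps.ne') ψ sq cb n hJ
    rw [hsq0, hsqn, abs_inv, abs_of_pos heps, inv_inv] at htel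
    have hsum : ∑ m' ∈ Finset.range n, ‖covD P.eps⁻¹ (cfg U) ψ (cb m')‖ ≤ n * B₁ := by
      calc ∑ m' ∈ Finset.range n, ‖covD P.eps⁻¹ (cfg U) ψ (cb m')‖ ≤ ∑ _m' ∈ Finset.range n, B₁ :=
            Finset.sum_le_sum fun m' hm' => hbond m' (Finset.mem_range.1 hm')
        _ = n * B₁ := by rw [Finset.sum_const, Finset.card_range, nsmul_eq_mul]
    have hdiff : ‖toC (chainHol sq cb U n) * ψ x₂ - ψ x₁‖ ≤ P.eps * (n * B₁) :=
      htel.trans (mul_le_mul_of_nonneg_left hsum heps.le)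
    -- the exponent: `D' ≥ D − T12 ≥ D − L^k`
    have hexpD' : Real.exp (-(δ₀ / 2 * (((P.L : ℝ) ^ k)⁻¹ * D'))) ≤ Real.exp (δ₀ / 2) * Ex := by
      have h1 : D - T12 ≤ D' := le_max_left _ _
      have h2 : ((P.L : ℝ) ^ k)⁻¹ * T12 ≤ 1 := by
        rw [inv_mul_le_iff₀ hLk, mul_one]; exact hnear
      have h3 : -(δ₀ / 2 * (((P.L : ℝ) ^ k)⁻¹ * D')) ≤ δ₀ / 2 + -(δ₀ / 2 * (((P.L : ℝ) ^ k)⁻¹ * D)) := by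
        have h4 : δ₀ / 2 * (((P.L : ℝ) ^ k)⁻¹ * (D - T12)) ≤ δ₀ / 2 * (((P.L : ℝ) ^ k)⁻¹ * D') :=
          mul_le_mul_of_nonneg_left (mul_le_mul_of_nonneg_left h1 hLkinv.le) (by positivity)
        have h6 : δ₀ / 2 * (((P.L : ℝ) ^ k)⁻¹ * T12) ≤ δ₀ / 2 * 1 := mul_le_mul_of_nonneg_left h2 (by positivity)
        have h7 : δ₀ / 2 * (((P.L : ℝ) ^ k)⁻¹ * (D - T12)) =
            δ₀ / 2 * (((P.L : ℝ) ^ k)⁻¹ * D) - δ₀ / 2 * (((P.L : ℝ) ^ k)⁻¹ * T12) := by ring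
        linarith
      calc Real.exp (-(δ₀ / 2 * (((P.L : ℝ) ^ k)⁻¹ * D'))) ≤ Real.exp (δ₀ / 2 + -(δ₀ / 2 * (((P.L : ℝ) ^ k)⁻¹ * D))) :=
            Real.exp_le_exp.2 h3
        _ = Real.exp (δ₀ / 2) * Ex := by rw [Real.exp_add]
    have hB₁le : B₁ ≤ P.spacing k * (Real.exp (δ₀ / 2) * c₁ * Br * Ex * F) := by
      rw [hB₁def, ← hmdef, ← hbrdef, ← hbr₁def, ← hδ₀def, ← hERdef, ← hER₁def]
      refine mul_le_mul_of_nonneg_left ?_ hsp0.le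
      calc c₁ * (m * br * ER + br₁ * ER₁) * Real.exp (-(δ₀ / 2 * (((P.L : ℝ) ^ k)⁻¹ * D'))) * F
          ≤ c₁ * Br * (Real.exp (δ₀ / 2) * Ex) * F :=
            mul_le_mul_of_nonneg_right (mul_le_mul_of_nonneg_left hexpD' (by positivity)) hF0
        _ = Real.exp (δ₀ / 2) * c₁ * Br * Ex * F := by ring
    -- the weight against the number of steps: `w·ε·n ≤ (d+1)·L^k·ε`
    have hwT : w * (P.eps * (n * B₁)) ≤ ((d : ℝ) + 1) * (P.eps * (P.L : ℝ) ^ k) * B₁ := by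
      rcases hT0.eq_or_lt with hT00 | hTpos
      · have hn0 : (n : ℝ) = 0 := le_antisymm (by rw [← hT00, mul_zero] at hnle; exact hnle) (Nat.cast_nonneg n)
        rw [hn0, zero_mul, mul_zero, mul_zero]
        positivity
      · have hq : 1 ≤ (P.L : ℝ) ^ k / T12 := by rw [le_div_iff₀ hTpos, one_mul]; exact hnear
        have hw1 : w ≤ (P.L : ℝ) ^ k / T12 := rpow_le_self_of_one_le hq hθ1
        calc w * (P.eps * (n * B₁)) ≤ (P.L : ℝ) ^ k / T12 * (P.eps * ((((d : ℝ) + 1) * T12) * B₁)) :=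
              mul_le_mul hw1 (mul_le_mul_of_nonneg_left (mul_le_mul_of_nonneg_right hnle hB₁0) heps.le) (by positivity)
                (div_nonneg hLk.le hT0)
          _ = ((d : ℝ) + 1) * (P.eps * (P.L : ℝ) ^ k) * B₁ := by
              rw [div_mul_eq_mul_div, div_eq_iff hTpos.ne']
              ring
    have hspacing : P.eps * (P.L : ℝ) ^ k = P.spacing k := by rw [Params.spacing]; ring
    calc w * ‖toC (chainHol sq cb U n) * ψ x₂ - ψ x₁‖ ≤ w * (P.eps * (n * B₁)) := mul_le_mul_of_nonneg_left hdiff hw0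
      _ ≤ ((d : ℝ) + 1) * (P.eps * (P.L : ℝ) ^ k) * B₁ := hwT
      _ ≤ ((d : ℝ) + 1) * P.spacing k * (P.spacing k * (Real.exp (δ₀ / 2) * c₁ * Br * Ex * F)) := by
          rw [hspacing]; exact mul_le_mul_of_nonneg_left hB₁le (by positivity)
      _ = P.spacing k ^ 2 * ((((d : ℝ) + 1) * Real.exp (δ₀ / 2) * c₁) * Br * Ex * F) := by ring
      _ ≤ P.spacing k ^ 2 * (C * Br * Ex * F) := by
          refine mul_le_mul_of_nonneg_left ?_ (sq_nonneg _)
          exact mul_le_mul_of_nonneg_right (mul_le_mul_of_nonneg_right (mul_le_mul_of_nonneg_right hC1 hBr0) hE0.le) hF0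
  · /- FAR PAIRS: two (2.31) value members, `|u(Γ)| = 1` -/
    push Not at hnear
    have hTpos : 0 < T12 := hLk.trans hnear
    have hw1 : w ≤ 1 := by
      refine Real.rpow_le_one (div_nonneg hLk.le hT0) ?_ hθ0
      rw [div_le_one hTpos]; exact hnear.le
    have hR0 : 0 ≤ R := le_trans (Nat.cast_nonneg _) hRm'.le
    have hv₁ := G2 P hPd hPL k hk1 hkK hks hsize A ec hec hece₂ hreg c M0 hfit0 sg W hsg R R₀ R₁ hRm' hR₁ hR10 hW hgap x₁ hx₁ hdeep₁
      f F D hF hD hsupp₁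
    have hv₂ := G2 P hPd hPL k hk1 hkK hks hsize A ec hec hece₂ hreg c M0 hfit0 sg W hsg R R₀ R₁ hRm' hR₁ hR10 hW hgap x₂ hx₂ hdeep₂
      f F D hF hD hsupp₂
    have hval : ∀ x : Balaban1983to89.Site P 0,
        ‖ψL x - ψΩ x‖ ≤ P.spacing k ^ 2 * (c₂ * (((⌊(((P.L : ℝ) ^ k) - 1 + R₀) / sg⌋₊ : ℝ) + 3) ^ (d + 1) *
            Real.exp (-(1 / (8 * (L : ℝ) ^ s) * (((P.L : ℝ) ^ k)⁻¹ * (2 * R)))) +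
              Real.exp (-(1 / (8 * (L : ℝ) ^ s) / 2 * (((P.L : ℝ) ^ k)⁻¹ * R₁)))) *
          Real.exp (-(1 / (8 * (L : ℝ) ^ s) / 2 * (((P.L : ℝ) ^ k)⁻¹ * D))) * F) → ‖ψ x‖ ≤ P.spacing k ^ 2 * (c₂ * Br * Ex * F) := by
      intro x hx
      rw [← hψ]
      refine hx.trans (mul_le_mul_of_nonneg_left ?_ (sq_nonneg _))
      rw [← hmdef, ← hδ₀def, ← hEdef]
      have hbr_le : m * Real.exp (-(δ₀ * (((P.L : ℝ) ^ k)⁻¹ * (2 * R)))) + Real.exp (-(δ₀ / 2 * (((P.L : ℝ) ^ k)⁻¹ * R₁))) ≤ Br := by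
        rw [hBrdef]
        refine add_le_add ?_ ?_
        · calc m * Real.exp (-(δ₀ * (((P.L : ℝ) ^ k)⁻¹ * (2 * R)))) ≤ m * ER := mul_le_mul_of_nonneg_left hER_2 hm0
            _ = m * 1 * ER := by ring
            _ ≤ m * br * ER := mul_le_mul_of_nonneg_right (mul_le_mul_of_nonneg_left hbr1 hm0) hER0.le
        · calc Real.exp (-(δ₀ / 2 * (((P.L : ℝ) ^ k)⁻¹ * R₁))) ≤ ER₁ := hER₁_2
            _ = 1 * ER₁ := (one_mul _).symm
            _ ≤ br₁ * ER₁ := mul_le_mul_of_nonneg_right hbr₁1 hER₁0.le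
      exact mul_le_mul_of_nonneg_right (mul_le_mul_of_nonneg_right (mul_le_mul_of_nonneg_left hbr_le hc₂.le) hE0.le) hF0
    have h1 := hval x₁ hv₁
    have h2 := hval x₂ hv₂
    have hsub : ‖toC (chainHol sq cb U n) * ψ x₂ - ψ x₁‖ ≤
        P.spacing k ^ 2 * (c₂ * Br * Ex * F) + P.spacing k ^ 2 * (c₂ * Br * Ex * F) := by
      refine (norm_sub_le _ _).trans (add_le_add ?_ h1)
      rw [norm_mul, norm_toC, one_mul]; exact h2
    calc w * ‖toC (chainHol sq cb U n) * ψ x₂ - ψ x₁‖ ≤ ‖toC (chainHol sq cb U n) * ψ x₂ - ψ x₁‖ :=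
          mul_le_of_le_one_left (norm_nonneg _) hw1
      _ ≤ P.spacing k ^ 2 * (c₂ * Br * Ex * F) + P.spacing k ^ 2 * (c₂ * Br * Ex * F) := hsub
      _ = P.spacing k ^ 2 * ((2 * c₂) * Br * Ex * F) := by ring
      _ ≤ P.spacing k ^ 2 * (C * Br * Ex * F) := by
          refine mul_le_mul_of_nonneg_left ?_ (sq_nonneg _)
          exact mul_le_mul_of_nonneg_right (mul_le_mul_of_nonneg_right (mul_le_mul_of_nonneg_right hC2 hBr0) hE0.le) hF0

end Holder

/-! ## §3 The member along the chart staircase: [6]'s *"shortest contour Γ_{x,x′}"* form for near deep pairs -/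

section ShortestContour

/-- **THE HÖLDER MEMBER OF ORDER `θ ≤ 1` OF (2.31), `Ω = T_η`, AT A (2.23)-REGULAR BACKGROUND, ALONG A SHORTEST CONTOUR** ([6] (1.9)'s form:
*"Here Γ_{x,x′} denotes a shortest contour connecting the points x, x′"*): with the thresholds and constants of `holder231_regular_torus_cwt`,
for every pair `x₁, x₂ ∈ Ω₀` at chart depth `≥ R₀ + R` with `|x₁ − x₂|_T ≤ R₀ + R` THERE IS a bond chain `Γ` from `x₁` to `x₂` of
`≤ (d+1)|x₁ − x₂|_T` steps (p29's chart staircase `exists_admissible_contour`) along which, for every `0 ≤ θ ≤ 1` and every `f` with `‖f‖_∞ ≤ F`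
supported at sup-torus distance `≥ D ≥ 0` from both points, the bound of `holder231_regular_torus_cwt` holds.
[cite: BalabanImbrieJaffe1988, (2.31) p.263] -/
theorem exists_contour_holder231_regular_torus_cwt (d L : ℕ) (hL : 2 ≤ L) {a : ℝ} (ha : 0 < a) (e creg β : ℝ) (hcreg : 0 ≤ creg)
    (hβ : 0 < β) :
    ∃ s₀ : ℕ, ∀ s : ℕ, s₀ ≤ s → ∃ c₀ e₁ : ℝ, 0 < c₀ ∧ 0 < e₁ ∧
      ∀ (P : Params) (hPd : P.d = d + 1), P.L = L → ∀ (k : ℕ), 1 ≤ k → k ≤ P.K → k + s ≤ P.m + P.K →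
      3 * (L ^ k * L ^ s) ≤ P.sitesPerDir 0 →
      ∀ (A : PBond P 0 → ℝ) (ec : ℝ), 0 < ec → ec ≤ e₁ →
      (∀ (z : Balaban1983to89.Site P 0) (μ ν : Fin P.d),
          P.spacing k * |e| / ec * |A ⟨z.shift μ, ν⟩ - A ⟨z, ν⟩| ≤ creg * ec ^ (β - 1) / (L : ℝ) ^ k) →
      ∀ (c M0 : Fin (d + 1) → ℕ), (∀ i, c i * P.L ^ k + P.L ^ k * M0 i ≤ P.sitesPerDir 0) → (∀ i, P.L ^ k * M0 i < P.sitesPerDir 0) →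
      ∀ (sg W : ℕ), 1 ≤ sg → ∀ (R R₀ R₁ : ℝ), ((rowMargin L (d + 1) k s : ℕ) : ℝ) + 1 < R → 0 ≤ R₁ → R₁ < R₀ →
        2 * (sg : ℝ) / 3 + R₀ / 2 + R ≤ W → (∀ i, ((P.L ^ k * M0 i : ℕ) : ℝ) + R ≤ P.sitesPerDir 0) →
      ∀ (x₁ x₂ : Balaban1983to89.Site P 0),
        x₁ ∈ (cubeT hPd (P.L ^ k) c fun i => P.L ^ k * M0 i) →
        (∀ i, R₀ + R ≤ (boxCoord hPd (P.L ^ k) c x₁ i : ℝ) ∧ (boxCoord hPd (P.L ^ k) c x₁ i : ℝ) + (R₀ + R) ≤ (P.L ^ k * M0 i : ℕ) - 1) →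
        x₂ ∈ (cubeT hPd (P.L ^ k) c fun i => P.L ^ k * M0 i) →
        (∀ i, R₀ + R ≤ (boxCoord hPd (P.L ^ k) c x₂ i : ℝ) ∧ (boxCoord hPd (P.L ^ k) c x₂ i : ℝ) + (R₀ + R) ≤ (P.L ^ k * M0 i : ℕ) - 1) →
        B5Ineq137Torus.T P 0 x₁ x₂ ≤ R₀ + R →
      ∃ (N : ℕ) (sq : ℕ → Balaban1983to89.Site P 0) (cb : ℕ → PBond P 0), sq 0 = x₁ ∧ sq N = x₂ ∧
        (∀ m < N, Joins (cb m) (sq m) (sq (m + 1))) ∧ (N : ℝ) ≤ ((d : ℝ) + 1) * B5Ineq137Torus.T P 0 x₁ x₂ ∧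
      ∀ (θ : ℝ), 0 ≤ θ → θ ≤ 1 →
      ∀ (f : Balaban1983to89.Site P 0 → ℂ) (F D : ℝ), (∀ y, ‖f y‖ ≤ F) → 0 ≤ D →
        (∀ y, f y ≠ 0 → D ≤ B5Ineq137Torus.T P 0 x₁ y) → (∀ y, f y ≠ 0 → D ≤ B5Ineq137Torus.T P 0 x₂ y) →
        ((P.L : ℝ) ^ k / B5Ineq137Torus.T P 0 x₁ x₂) ^ θ *
          ‖toC (chainHol sq cb (expGauge P e A) N) *
              ((gLocT (B1RG242Torus.α P a k * (P.L : ℝ) ^ (k * P.d)) P.eps⁻¹ (expGauge P e A) k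
                  (cubeFamB hPd (P.L ^ k) c M0 sg W (L ^ k * L ^ s)) (lamFam hPd (P.L ^ k) c M0 sg)
                  (cutoff R₁ R₀ (B5Ineq137Torus.T P 0)) *ᵥ f) x₂ -
                (gBox (B1RG242Torus.α P a k * (P.L : ℝ) ^ (k * P.d)) P.eps⁻¹ (expGauge P e A) k univ *ᵥ f) x₂) -
            ((gLocT (B1RG242Torus.α P a k * (P.L : ℝ) ^ (k * P.d)) P.eps⁻¹ (expGauge P e A) k
                  (cubeFamB hPd (P.L ^ k) c M0 sg W (L ^ k * L ^ s)) (lamFam hPd (P.L ^ k) c M0 sg)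
                  (cutoff R₁ R₀ (B5Ineq137Torus.T P 0)) *ᵥ f) x₁ -
                (gBox (B1RG242Torus.α P a k * (P.L : ℝ) ^ (k * P.d)) P.eps⁻¹ (expGauge P e A) k univ *ᵥ f) x₁)‖ ≤
          P.spacing k ^ 2 * (c₀ * ((⌊(((P.L : ℝ) ^ k) - 1 + R₀) / sg⌋₊ + 3) ^ (d + 1) * (1 + (P.L : ℝ) ^ k * ((R₀ - R₁)⁻¹ + (sg : ℝ)⁻¹)) *
              Real.exp (-(1 / (8 * (L : ℝ) ^ s) * (((P.L : ℝ) ^ k)⁻¹ * (2 * R - 1)))) +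
            (1 + (P.L : ℝ) ^ k * (R₀ - R₁)⁻¹) * Real.exp (-(1 / (8 * (L : ℝ) ^ s) / 2 * (((P.L : ℝ) ^ k)⁻¹ * (R₁ - 1))))) *
            Real.exp (-(1 / (8 * (L : ℝ) ^ s) / 2 * (((P.L : ℝ) ^ k)⁻¹ * D))) * F) := by
  obtain ⟨s₀, H⟩ := holder231_regular_torus_cwt d L hL ha e creg β hcreg hβ
  refine ⟨s₀, fun s hs => ?_⟩
  obtain ⟨c₀, e₁, hc₀, he₁, G⟩ := H s hs
  refine ⟨c₀, e₁, hc₀, he₁, ?_⟩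
  intro P hPd hPL k hk1 hkK hks hsize A ec hec hece hreg c M0 hfit0 hN0 sg W hsg R R₀ R₁ hRm hR₁ hR10 hW hgap x₁ x₂ hx₁ hdeep₁ hx₂
    hdeep₂ hT
  obtain ⟨N, sq, cb, h0, hN, hJ, hNle, hchain⟩ := exists_admissible_contour hPd hfit0 hx₁ hdeep₁ hx₂ hdeep₂ hT
  refine ⟨N, sq, cb, h0, hN, hJ, hNle, fun θ hθ0 hθ1 f F D hF hD hD₁ hD₂ => ?_⟩
  have hchain' : ∀ m ≤ N, sq m ∈ (cubeT hPd (P.L ^ k) c fun i => P.L ^ k * M0 i) ∧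
      (∀ i, R₀ + R ≤ (boxCoord hPd (P.L ^ k) c (sq m) i : ℝ) ∧ (boxCoord hPd (P.L ^ k) c (sq m) i : ℝ) + (R₀ + R) ≤ (P.L ^ k * M0 i : ℕ) - 1) ∧
      B5Ineq137Torus.T P 0 x₁ (sq m) ≤ B5Ineq137Torus.T P 0 x₁ x₂ := fun m hm => by
    obtain ⟨h1, h2, h3⟩ := hchain m hm
    exact ⟨h1, fun i => by simpa only [min_self] using h2 i, h3⟩
  exact G P hPd hPL k hk1 hkK hks hsize A ec hec hece hreg c M0 hfit0 hN0 sg W hsg R R₀ R₁ hRm hR₁ hR10 hW hgap θ hθ0 hθ1 x₁ x₂ N sq cb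
    h0 hN hJ hNle hchain' f F D hF hD hD₁ hD₂

end ShortestContour

end

end Literature.MathematicalPhysics.QuantumFieldTheory.BalabanImbrieJaffe1984to88.BIJ88LocHolder231RegularTorus
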